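import Mathlib
import Summits.ValiantsHypothesis.ValiantsHypothesis.Theorems.LacunarySymmetroidMatrixDescartesMonotoneFlagEnds

/-!
# `MatrixDescartes` (stmt-ValiantsHypothesis-18050) — FLAG FORM OF THE EXACT MONOTONE COUNT, III (assembly): on the monotone sector,
# with NO invertibility anywhere, `Z₊(mult) + dim W_U + dim W_L = m + ν(S₀|W_L) + π(S₀|W_U)`

HONEST FRAMING.  Cell `pub-symmetroid`, seat `val-sym-mdr-p2` (gen 22); helper file `--supports` the crux
`Theses.LacunarySymmetroid.MatrixDescartes` (OPEN), NO closure claim.  Assembles `…MonotoneFlag` (THE FLAG BOUND, `≤`), `…MonotoneFlagCore`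
(one-rate core lemma) and `…MonotoneFlagEnds` (end inertias, `≥`) into the EQUALITY.  An exact SECTOR COUNT beside the crux: nothing
here bears on the crux in its window, `stub_twoSided`, `DoorA26` / `DoorA34`, registers, or `VP ≠ VNP`.

SETTING (crux currency).  Real symmetric letters `S l` (`l : κ`) of size `ι`, exponents `d l`, pivot index `l₀`, `S₀ := S l₀` ARBITRARY
(singular allowed); MONOTONE SECTOR: every other letter PSD with `d l > d l₀` (UPPER) or NSD with `d l < d l₀` (LOWER); `det F ≢ 0` for
`F(X) = Σ_l X^{d l} S l`.  `B_U : ι × α`, `B_L : ι × β` FULL BASES of the joint kernels `W_U = ⋂_{upper} ker S l`, `W_L = ⋂_{lower} ker S l`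
(injective, killed by the respective letters, spanning); `C_U = B_Uᵀ S₀ B_U`, `C_L = B_Lᵀ S₀ B_L`.

* **`monotone_pencil_flag_exact` (THE FLAG FORM OF THE EXACT MONOTONE COUNT).**  The positive roots of `det F` counted WITH MULTIPLICITY
  satisfy `Z₊ + card α + card β = card ι + ν(C_L) + π(C_U)`, i.e.
      `Z₊(mult) = [codim W_L + ν(S₀|W_L)] − [dim W_U − π(S₀|W_U)] = ν(F(0⁺)) − ν(F(∞))`.
  PROOF: `≤` is `monotone_pencil_flag_bound`; for `≥`, the window law `GramDual.monotone_pencil_card_posRoots_multiset_eq_window` (positive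
  type) between a non-singular scale `a` below `ε` and all positive roots and a scale `b` above `X` and all roots, and the end
  inequalities of `…MonotoneFlagEnds` at `a` and `b`.
* `monotone_pencil_flag_exact_oneSided` — no lower letters (`B_L = 1`): `Z₊(mult) + dim W_U = ν(S₀) + π(S₀|W_U)`, i.e.
  `Z₊(mult) = ν(S₀) − ν̄(S₀|W_U)` (`ν̄` = number of non-positive eigenvalues of the compression).  This is the tree's one-sided exact law
  (`oneSided_pencil_card_posRoots_multiset_eq`, which needs `det S₀ ≠ 0`) and `Inertia.firstRung_exact` (which needs a non-singular top
  letter) with NO non-singularity hypothesis on any letter.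
* `monotone_pencil_flag_sterile_iff` — `det F` has no positive root iff `dim W_U + dim W_L = m + ν(S₀|W_L) + π(S₀|W_U)`.
READING.  The exact monotone count of gen 21 (`det S₀ ≠ 0`: `Z₊(mult) = ν(Gram₊₊) + π(Gram₋₋)`), its singular three-letter form
(`threeLetters_singular_card_posRoots_multiset_eq`) and the two-step flags are faces of ONE identity in which only the joint kernels of the
two letter groups and two compressions of the pivot enter; on the monotone sector semidefiniteness makes every nested kernel contribute its
full dimension with a definite sign, so no flag and no Gram inverse is needed.  Instances (paper): `m = 2`, `S₀ = [[0,1],[1,0]]`, upper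
`e₁e₁ᵀ`: `Z₊ = 0`, `0 + 1 + 2 = 2 + 1 + 0`; `S₀ = −1`, upper `1` (`m = 2`): double root, `2 + 0 + 2 = 2 + 2 + 0`; `m = 3`,
`S₀ = [[a,0,1],[0,1,0],[1,0,0]]`, upper `e₁e₁ᵀ`, lower `−e₂e₂ᵀ`: one simple root, `1 + 2 + 2 = 3 + 1 + 1`; `K = 3`, `m = 2`, `S₊ = uuᵀ`,
`S₋ = −vvᵀ` (`u = (1,1)`, `v = (1,−1)`), `S₀ = diag(1,−1)`: `det = −4x^{g−h} − 1`, `Z₊ = 0`, `0 + 1 + 1 = 2 + 0 + 0`.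

[folklore] (Sylvester's law of inertia; Loewner monotonicity).  Axioms `propext`, `Classical.choice`, `Quot.sound`.  No definitions.
-/

-- layout Summits/ValiantsHypothesis/ValiantsHypothesis forces the duplicated namespace component
set_option linter.dupNamespace false

namespace Summit.ValiantsHypothesis.ValiantsHypothesis.Theorems.LacunarySymmetroidMatrixDescartes

open Polynomial Matrix Finset
open scoped BigOperators Topology

namespace GramDual

/-! ## §4 The flag form of the exact monotone count -/

section Exact

variable {ι κ : Type} [Fintype ι] [DecidableEq ι] [Fintype κ] [DecidableEq κ]

/-- **THE FLAG FORM OF THE EXACT MONOTONE COUNT (no invertibility anywhere).**  Monotone sector (pivot letter `S₀ = S l₀` arbitrary,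
PSD letters above, NSD letters below, `det F ≢ 0`); `B_U`, `B_L` FULL bases (injective, killed by, and spanning the joint kernel of) the
upper, resp. lower, letters; `C_U = B_Uᵀ S₀ B_U`, `C_L = B_Lᵀ S₀ B_L`.  Then the positive roots of `det F` counted WITH MULTIPLICITY satisfy
`Z₊ + card α + card β = card ι + ν(C_L) + π(C_U)`, i.e. `Z₊ = (m − dim W_L + ν(S₀|W_L)) − (dim W_U − π(S₀|W_U)) = ν(F(0⁺)) − ν(F(∞))`.
[folklore] -/
theorem monotone_pencil_flag_exact (d : κ → ℕ) (S : κ → Matrix ι ι ℝ) (hS : ∀ l, (S l).IsSymm) (l₀ : κ)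
    (hmono : ∀ l, l ≠ l₀ → ((S l).PosSemidef ∧ d l₀ < d l) ∨ ((-(S l)).PosSemidef ∧ d l < d l₀))
    (hdet : Matrix.det (∑ l, ((Polynomial.X : Polynomial ℝ) ^ d l) • (S l).map Polynomial.C) ≠ 0)
    {α β : Type} [Fintype α] [DecidableEq α] [Fintype β] [DecidableEq β]
    (BU : Matrix ι α ℝ) (hBU : ∀ l, d l₀ < d l → S l * BU = 0) (hBUi : Function.Injective BU.mulVec)
    (hBUspan : ∀ v : ι → ℝ, (∀ l, d l₀ < d l → S l *ᵥ v = 0) → ∃ c : α → ℝ, BU *ᵥ c = v)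
    (BL : Matrix ι β ℝ) (hBL : ∀ l, d l < d l₀ → S l * BL = 0) (hBLi : Function.Injective BL.mulVec)
    (hBLspan : ∀ v : ι → ℝ, (∀ l, d l < d l₀ → S l *ᵥ v = 0) → ∃ c : β → ℝ, BL *ᵥ c = v)
    (hCU : (BUᵀ * S l₀ * BU).IsHermitian) (hCL : (BLᵀ * S l₀ * BL).IsHermitian) :
    Multiset.card ((Matrix.det (∑ l, ((Polynomial.X : Polynomial ℝ) ^ d l) • (S l).map Polynomial.C)).roots.filter
        (fun t => 0 < t)) + Fintype.card α + Fintype.card β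
      = Fintype.card ι + Fintype.card {j // hCL.eigenvalues j < 0} + Fintype.card {j // 0 < hCU.eigenvalues j} := by
  classical
  refine le_antisymm (monotone_pencil_flag_bound d S hS l₀ hmono hdet BU hBU hBUi BL hBL hBLi hCU hCL) ?_
  set P := Matrix.det (∑ l, ((Polynomial.X : Polynomial ℝ) ^ d l) • (S l).map Polynomial.C) with hPdef
  obtain ⟨X, hX, hlarge⟩ := eventually_negIndex_add_posIndex_le_card d S hS l₀ hmono BU hBU hBUspan hCU
  obtain ⟨ε, hε, hsmall⟩ := eventually_card_add_negIndex_le_negIndex_add_card d S hS l₀ hmono BL hBL hBLspan hCL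
  -- scales: `b` above every root and above `X`, `a` below every positive root and below `ε`
  set b : ℝ := max X (2 + (P.roots.toFinset.sum fun t => |t|)) with hbdef
  set a : ℝ := min ε (1 + ((P.roots.toFinset.filter (fun t => 0 < t)).sum fun t => t⁻¹))⁻¹ with hadef
  have hsumnn : 0 ≤ P.roots.toFinset.sum fun t => |t| := Finset.sum_nonneg fun t _ => abs_nonneg t
  have hsum'nn : 0 ≤ (P.roots.toFinset.filter (fun t => 0 < t)).sum fun t => t⁻¹ :=
    Finset.sum_nonneg fun t ht => (inv_pos.2 (Finset.mem_filter.1 ht).2).le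
  have hb2 : 2 ≤ b := le_trans (by linarith) (le_max_right _ _)
  have hbX : X ≤ b := le_max_left _ _
  have hbpos : 0 < b := by linarith
  have hapos : 0 < a := lt_min hε (by positivity)
  have haε : a ≤ ε := min_le_left _ _
  have ha1 : a ≤ 1 := le_trans (min_le_right _ _) (inv_le_one_of_one_le₀ (by linarith))
  have hab : a < b := by linarith
  have hroot_lt_b : ∀ t ∈ P.roots, t < b := by
    intro t ht
    have hmem : t ∈ P.roots.toFinset := Multiset.mem_toFinset.2 ht
    have h1 : |t| ≤ P.roots.toFinset.sum fun t => |t| :=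
      Finset.single_le_sum (f := fun t => |t|) (fun t _ => abs_nonneg t) hmem
    have h2 : t ≤ |t| := le_abs_self t
    have h3 : 2 + (P.roots.toFinset.sum fun t => |t|) ≤ b := le_max_right _ _
    linarith
  have hroot_gt_a : ∀ t ∈ P.roots, 0 < t → a < t := by
    intro t ht htpos
    have hmem : t ∈ P.roots.toFinset.filter (fun t => 0 < t) :=
      Finset.mem_filter.2 ⟨Multiset.mem_toFinset.2 ht, htpos⟩
    have h1 : t⁻¹ ≤ (P.roots.toFinset.filter (fun t => 0 < t)).sum fun t => t⁻¹ :=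
      Finset.single_le_sum (f := fun t => t⁻¹) (fun s hs => (inv_pos.2 (Finset.mem_filter.1 hs).2).le) hmem
    have h2 : t⁻¹ < 1 + (P.roots.toFinset.filter (fun t => 0 < t)).sum fun t => t⁻¹ := by linarith
    calc a ≤ (1 + (P.roots.toFinset.filter (fun t => 0 < t)).sum fun t => t⁻¹)⁻¹ := min_le_right _ _
      _ < t⁻¹⁻¹ := inv_strictAnti₀ (inv_pos.2 htpos) h2
      _ = t := inv_inv t
  have hmem_of_det : ∀ s : ℝ, (∑ l, s ^ d l • S l).det = 0 → s ∈ P.roots := by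
    intro s h0
    rw [Polynomial.mem_roots hdet, Polynomial.IsRoot.def, hPdef, DefiniteMoments.eval_det_pencil]
    exact h0
  have ha : (∑ l, a ^ d l • S l).det ≠ 0 := fun h0 =>
    lt_irrefl a (hroot_gt_a a (hmem_of_det a h0) hapos)
  have hb : (∑ l, b ^ d l • S l).det ≠ 0 := fun h0 =>
    lt_irrefl b (hroot_lt_b b (hmem_of_det b h0))
  have hwin := monotone_pencil_card_posRoots_multiset_eq_window d S hS l₀ hmono hapos hab ha hb
    (fun t ht htpos => ⟨hroot_gt_a t ht htpos, hroot_lt_b t ht⟩)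
  rw [← hPdef] at hwin
  have h1 := hlarge b hbX
  have h2 := hsmall a hapos haε
  omega

/-- **Exact count, one-sided form** (no lower letters, `B_L = 1`): PSD letters above an ARBITRARY pivot `S₀`, `det F ≢ 0`, `B_U` a full
basis of the joint kernel of the upper letters ⇒ `Z₊(mult) + card α = ν(S₀) + π(B_Uᵀ S₀ B_U)`, i.e. `Z₊(mult) = ν(S₀) − ν̄(S₀|W_U)`.
This is the tree's one-sided exact law (`oneSided_pencil_card_posRoots_multiset_eq`, `det S₀ ≠ 0`) and `Inertia.firstRung_exact`
(non-singular top letter) with NO non-singularity hypothesis on any letter. [folklore] -/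
theorem monotone_pencil_flag_exact_oneSided (d : κ → ℕ) (S : κ → Matrix ι ι ℝ) (hS : ∀ l, (S l).IsSymm) (l₀ : κ)
    (hup : ∀ l, l ≠ l₀ → (S l).PosSemidef ∧ d l₀ < d l)
    (hdet : Matrix.det (∑ l, ((Polynomial.X : Polynomial ℝ) ^ d l) • (S l).map Polynomial.C) ≠ 0)
    {α : Type} [Fintype α] [DecidableEq α]
    (BU : Matrix ι α ℝ) (hBU : ∀ l, d l₀ < d l → S l * BU = 0) (hBUi : Function.Injective BU.mulVec)
    (hBUspan : ∀ v : ι → ℝ, (∀ l, d l₀ < d l → S l *ᵥ v = 0) → ∃ c : α → ℝ, BU *ᵥ c = v)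
    (hCU : (BUᵀ * S l₀ * BU).IsHermitian) (h₀ : (S l₀).IsHermitian) :
    Multiset.card ((Matrix.det (∑ l, ((Polynomial.X : Polynomial ℝ) ^ d l) • (S l).map Polynomial.C)).roots.filter
        (fun t => 0 < t)) + Fintype.card α
      = Fintype.card {j // h₀.eigenvalues j < 0} + Fintype.card {j // 0 < hCU.eigenvalues j} := by
  classical
  have hmono : ∀ l, l ≠ l₀ → ((S l).PosSemidef ∧ d l₀ < d l) ∨ ((-(S l)).PosSemidef ∧ d l < d l₀) :=
    fun l hl => Or.inl (hup l hl)
  have hnolow : ∀ l, ¬ d l < d l₀ := by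
    intro l hdl
    by_cases hl : l = l₀
    · rw [hl] at hdl; exact lt_irrefl _ hdl
    · exact absurd (hup l hl).2 (not_lt.2 hdl.le)
  have hBL : ∀ l, d l < d l₀ → S l * (1 : Matrix ι ι ℝ) = 0 := fun l hdl => absurd hdl (hnolow l)
  have hBLi : Function.Injective (1 : Matrix ι ι ℝ).mulVec := fun u v h => by simpa using h
  have hBLspan : ∀ v : ι → ℝ, (∀ l, d l < d l₀ → S l *ᵥ v = 0) → ∃ c : ι → ℝ, (1 : Matrix ι ι ℝ) *ᵥ c = v :=
    fun v _ => ⟨v, Matrix.one_mulVec v⟩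
  have hCL : ((1 : Matrix ι ι ℝ)ᵀ * S l₀ * 1).IsHermitian := by
    rw [Matrix.transpose_one, Matrix.one_mul, Matrix.mul_one]; exact h₀
  have h := monotone_pencil_flag_exact d S hS l₀ hmono hdet BU hBU hBUi hBUspan 1 hBL hBLi hBLspan hCU hCL
  have hν : Fintype.card {j // hCL.eigenvalues j < 0} = Fintype.card {j // h₀.eigenvalues j < 0} :=
    Inertia.negIndex_congr hCL h₀ (by rw [Matrix.transpose_one, Matrix.one_mul, Matrix.mul_one])
  rw [hν] at h
  omega

/-- **Sterility criterion on the monotone sector (no invertibility)**: with full bases, `det F` has NO positive root iff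
`card α + card β = card ι + ν(C_L) + π(C_U)`, i.e. `dim W_U + dim W_L = m + ν(S₀|W_L) + π(S₀|W_U)`. [folklore] -/
theorem monotone_pencil_flag_sterile_iff (d : κ → ℕ) (S : κ → Matrix ι ι ℝ) (hS : ∀ l, (S l).IsSymm) (l₀ : κ)
    (hmono : ∀ l, l ≠ l₀ → ((S l).PosSemidef ∧ d l₀ < d l) ∨ ((-(S l)).PosSemidef ∧ d l < d l₀))
    (hdet : Matrix.det (∑ l, ((Polynomial.X : Polynomial ℝ) ^ d l) • (S l).map Polynomial.C) ≠ 0)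
    {α β : Type} [Fintype α] [DecidableEq α] [Fintype β] [DecidableEq β]
    (BU : Matrix ι α ℝ) (hBU : ∀ l, d l₀ < d l → S l * BU = 0) (hBUi : Function.Injective BU.mulVec)
    (hBUspan : ∀ v : ι → ℝ, (∀ l, d l₀ < d l → S l *ᵥ v = 0) → ∃ c : α → ℝ, BU *ᵥ c = v)
    (BL : Matrix ι β ℝ) (hBL : ∀ l, d l < d l₀ → S l * BL = 0) (hBLi : Function.Injective BL.mulVec)
    (hBLspan : ∀ v : ι → ℝ, (∀ l, d l < d l₀ → S l *ᵥ v = 0) → ∃ c : β → ℝ, BL *ᵥ c = v)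
    (hCU : (BUᵀ * S l₀ * BU).IsHermitian) (hCL : (BLᵀ * S l₀ * BL).IsHermitian) :
    (Matrix.det (∑ l, ((Polynomial.X : Polynomial ℝ) ^ d l) • (S l).map Polynomial.C)).roots.filter (fun t => 0 < t) = 0
      ↔ Fintype.card α + Fintype.card β
        = Fintype.card ι + Fintype.card {j // hCL.eigenvalues j < 0} + Fintype.card {j // 0 < hCU.eigenvalues j} := by
  have h := monotone_pencil_flag_exact d S hS l₀ hmono hdet BU hBU hBUi hBUspan BL hBL hBLi hBLspan hCU hCL
  rw [← Multiset.card_eq_zero]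
  omega

end Exact

end GramDual

end Summit.ValiantsHypothesis.ValiantsHypothesis.Theorems.LacunarySymmetroidMatrixDescartes
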